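import Literature.AnabelianGeometry.SemiGraphs.QuasiTemperoidsQDPairFunctor
import Literature.AnabelianGeometry.SemiGraphs.QuasiTemperoidsCharts
import Literature.AlgebraicGeometry.Frobenioids.QuasiTemperoidConnectedPart
import Mathlib.CategoryTheory.SingleObj
import Mathlib.CategoryTheory.Countable
import Mathlib.Algebra.FreeMonoid.Basic
import HarnessLib

/-!
# Semi-graphs of anabelioids, Appendix, proof of Theorem A.4: `φ^*` preserves quotients of QD-pairs
# and 1-proper morphisms (proofs)

Mochizuki, *Semi-graphs of anabelioids*, Publ. RIMS **42** (2006) 221–322, Appendix, proof of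
Theorem A.4, manuscript p. 85 (PRIMS p. 315 ll. 19–22)
[cite: MochizukiSemiAnbd2006, Thm A.4 proof p.85]: "since `φ^*` preserves countable colimits, it
follows that the functor `D₂ → D₁` preserves 0- and 1-proper morphisms [cf. Remark A.3.1]", with
Remark A.3.1, last sentences (p. 82): "the notion of a quotient of a QD-pair … may also be stated in
terms of colimits … a similar statement holds for the notion of a 1-proper morphism".

Sub-node **A4-φ** of `plan/L3/SUBDAG-SemiAnbd-Cor311.md` (holder abc-iut-w5-d129), part 2 of 2,
PROOF-ONLY companion of `QuasiTemperoidsQDPairFunctor.lean` (`QDPair.mapFunctor`):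

* `QDPair.overPrime_exists_seq_detecting`, `QDPair.exists_seq_detecting` — the one non-formal point:
  `Γ_A ⊆ Aut(A)` may be UNCOUNTABLE (e.g. the symmetric group of `ℕ` acting on `⊔_ℕ Π/H ∈ T[A]`), but
  in a connected quasi-temperoid the `Γ_A`-invariance of an arrow out of `A` is detected by a
  SEQUENCE `γ_n ∈ Γ_A` (in a chart `Q ≌ T[A₀] ⊆ B^temp(Π)` the `Γ_A`-orbit relation on the countable
  set of points of `A` is countably witnessed);
* `QDPair.IsQuotient.map_of_preservesCountableColimits` — hence a quotient `A → A/Γ_A` is a colimit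
  of the COUNTABLE one-object diagram `(A; words in the γ_n)`, and a functor preserving countable
  colimits carries quotients of QD-pairs to quotients of QD-pairs;
* `QDPair.Hom.IsOneProper.map` (and `…_of_preservesCountableColimits`) — `D₂ → D₁` PRESERVES 1-PROPER
  MORPHISMS; `…_pullback` corollaries in the setting of `ThmA4` (`φ : TemperoidHom T₁[A₁] T₂[A₂]`).

No definitions; elementary category / `Π`-set theory; nothing refers to the IUT corpus; no side is
taken on any disputed claim.
-/

open CategoryTheory CategoryTheory.Limits Topology

namespace Literature.AnabelianGeometry.SemiGraphs

open Literature.AlgebraicGeometry.Frobenioids (IsConnectedObj)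
open Literature.AlgebraicGeometry.Frobenioids.QuasiTemperoid (IsConnectedQuasiTemperoid)
open Literature.AlgebraicGeometry.Frobenioids.QuasiTemperoid.BTempConnected (hom_ext_apply)

universe v₁ v₂ u u' u₁ u₂

namespace QDPair

/-! ### Countable detection of `Γ_A`-invariance, and quotients as countable colimits -/

section Detect

variable {G : Type u} [Group G] [TopologicalSpace G] [IsTopologicalGroup G]

omit [IsTopologicalGroup G] in
/-- **`Γ`-invariance is countably detected in `T[A] ⊆ B^temp(Π)`**: for an object `X` of `T[A]` and ANY
subgroup `Γ ⊆ Aut(X)` there is a sequence `γ_n ∈ Γ` such that an arrow `ψ : X → C` of `T[A]` with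
`ψ ∘ γ_n = ψ` for all `n` satisfies `ψ ∘ γ = ψ` for all `γ ∈ Γ`.  (The points of `X` form a countable
set; for each of the countably many pairs of points in one `Γ`-orbit choose one element of `Γ`
carrying the first to the second.) [cite: MochizukiSemiAnbd2006, Rmk A.3.1 p.82] -/
theorem overPrime_exists_seq_detecting {A₀ : BTemp G} (X : Over' A₀) (Γ : Subgroup (Aut X)) :
    ∃ γ : ℕ → Aut X, (∀ n, γ n ∈ Γ) ∧
      ∀ ⦃C : Over' A₀⦄ (ψ : X ⟶ C), (∀ n, (γ n).hom ≫ ψ = ψ) → ∀ δ ∈ Γ, δ.hom ≫ ψ = ψ := by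
  classical
  let V : Type u := X.obj.obj.V
  haveI : Countable V := X.obj.property.1
  -- pairs of points in one `Γ`-orbit, each with a chosen witness in `Γ`
  let S := {p : V × V // ∃ δ ∈ Γ, (δ.hom.hom.hom.hom p.1 : V) = p.2}
  have hS : ∀ p : S, ∃ δ ∈ Γ, (δ.hom.hom.hom.hom p.1.1 : V) = p.1.2 := fun p => p.2
  choose w hwΓ hw using hS
  let g : Option S → Aut X := fun o => o.elim 1 w
  have hgΓ : ∀ o, g o ∈ Γ := by
    rintro (_ | p)
    exacts [Γ.one_mem, hwΓ p]
  obtain ⟨e, he⟩ := exists_surjective_nat (Option S)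
  refine ⟨fun n => g (e n), fun n => hgΓ _, fun C ψ hψ δ hδ => ?_⟩
  refine ObjectProperty.hom_ext _ (hom_ext_apply fun a => ?_)
  -- the pair `(a, δ a)` is witnessed by some `γ_n = w (a, δ a)`
  let p : S := ⟨(a, δ.hom.hom.hom.hom a), δ, hδ, rfl⟩
  obtain ⟨n, hn⟩ := he (some p)
  have h₁ := congrArg (fun χ : X ⟶ C => (χ.hom.hom.hom a : C.obj.obj.V)) (hψ n)
  change (ψ.hom.hom.hom ((g (e n)).hom.hom.hom.hom a) : C.obj.obj.V) = ψ.hom.hom.hom a at h₁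
  rw [hn] at h₁
  change (ψ.hom.hom.hom ((w p).hom.hom.hom.hom a) : C.obj.obj.V) = ψ.hom.hom.hom a at h₁
  rw [hw p] at h₁
  exact h₁

end Detect

section Quotients

variable {Q : Type u₁} [Category.{v₁} Q] {Q' : Type u₂} [Category.{v₂} Q']

/-- **`Γ_A`-invariance is countably detected** in a connected quasi-temperoid `Q`: every QD-pair-like
datum `(A, Γ ⊆ Aut(A))` admits a sequence `γ_n ∈ Γ` such that an arrow out of `A` fixed by every
`γ_n` is fixed by all of `Γ` (transport of `overPrime_exists_seq_detecting` along a chart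
`Q ≌ T[A₀]`, Def. A.1 (i)). [cite: MochizukiSemiAnbd2006, Rmk A.3.1 p.82] -/
theorem exists_seq_detecting (hQ : IsConnectedQuasiTemperoid.{v₁, u₁, u} Q) (A : Q)
    (Γ : Subgroup (Aut A)) :
    ∃ γ : ℕ → Aut A, (∀ n, γ n ∈ Γ) ∧
      ∀ ⦃C : Q⦄ (ψ : A ⟶ C), (∀ n, (γ n).hom ≫ ψ = ψ) → ∀ δ ∈ Γ, δ.hom ≫ ψ = ψ := by
  obtain ⟨c⟩ := isConnectedQuasiTemperoid_iff_nonempty_chart.mp hQ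
  let F := c.equiv.functor
  obtain ⟨γ', hγ'Γ, hdet⟩ := overPrime_exists_seq_detecting (F.obj A) (Γ.map (Functor.mapAut A F))
  have hpre : ∀ n, ∃ γ ∈ Γ, Functor.mapAut A F γ = γ' n := fun n => Subgroup.mem_map.mp (hγ'Γ n)
  choose γ hγΓ hγeq using hpre
  refine ⟨γ, hγΓ, fun C ψ hψ δ hδ => F.map_injective ?_⟩
  have hψ' : ∀ n, (γ' n).hom ≫ F.map ψ = F.map ψ := fun n => by
    rw [← hγeq n]
    change F.map (γ n).hom ≫ F.map ψ = F.map ψ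
    rw [← F.map_comp, hψ n]
  have h := hdet (F.map ψ) hψ' (Functor.mapAut A F δ) (Subgroup.mem_map_of_mem _ hδ)
  change F.map δ.hom ≫ F.map ψ = F.map ψ at h
  rw [F.map_comp]
  exact h

/-- `Hom`-sets of the one-object category of the free monoid on `ℕ` are countable. [folklore] -/
private theorem countable_freeMonoid_nat : Countable (FreeMonoid ℕ) :=
  (FreeMonoid.toList (α := ℕ)).injective.countable

/-- The one-object category of the free monoid on `ℕ` is a countable category. [folklore] -/
private theorem countableCategory_singleObj_freeMonoid :
    CountableCategory (SingleObj (FreeMonoid ℕ)) where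
  countableObj := inferInstance
  countableHom := fun _ _ => countable_freeMonoid_nat

/-- The word `γ_{n₁} ⋯ γ_{n_k}` of a sequence `γ_n ∈ Γ` lies in `Γ`. [folklore] -/
private theorem freeMonoid_lift_mem {A : Q} (Γ : Subgroup (Aut A)) (γ : ℕ → Aut A)
    (hγ : ∀ n, γ n ∈ Γ) (x : FreeMonoid ℕ) : FreeMonoid.lift γ x ∈ Γ := by
  induction x using FreeMonoid.inductionOn' with
  | one => rw [map_one]; exact Γ.one_mem
  | mul_of b a ih => rw [map_mul, FreeMonoid.lift_eval_of]; exact Γ.mul_mem (hγ b) ih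

/-- **A functor preserving countable colimits preserves quotients of QD-pairs** (proof of Thm. A.4,
p. 85, with Remark A.3.1's "the notion of a quotient of a QD-pair … may also be stated in terms of
colimits"): if `Q` is a connected quasi-temperoid and `φ : A → B` forms a quotient of `(A, Γ_A)` in
`Q`, then `F φ` forms a quotient of `(F A, F(Γ_A))` in `Q'`.  Proof: choose a detecting sequence
`γ_n ∈ Γ_A` (`exists_seq_detecting`); then `φ` is a colimit of the COUNTABLE diagram on the single
object `A` with arrows the words in the `γ_n` (an arrow out of `A` is a cocone iff it is fixed by
every `γ_n`, iff it is `Γ_A`-invariant), `F` preserves this colimit, and a cocone on the image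
diagram is exactly an arrow out of `F A` fixed by every `F γ_n` — in particular every
`F(Γ_A)`-invariant arrow. [cite: MochizukiSemiAnbd2006, Thm A.4 proof p.85] -/
theorem IsQuotient.map_of_preservesCountableColimits (hQ : IsConnectedQuasiTemperoid.{v₁, u₁, u} Q)
    (F : Q ⥤ Q')
    (hF : ∀ (J : Type) [SmallCategory J] [CountableCategory J], PreservesColimitsOfShape J F)
    {P : QDPair Q} {B : Q} {φ : P.A ⟶ B} (hφ : P.IsQuotient φ) :
    ((mapFunctor F).obj P).IsQuotient (F.map φ) := by
  obtain ⟨γ, hγΓ, hdet⟩ := exists_seq_detecting hQ P.A P.Γ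
  have hlift := freeMonoid_lift_mem P.Γ γ hγΓ
  -- the countable diagram `(A; words in the γ_n)` and its cocone `φ`
  let D : SingleObj (FreeMonoid ℕ) ⥤ Q :=
    { obj := fun _ => P.A
      map := fun x => (FreeMonoid.lift γ x).hom
      map_id := fun _ => by rw [SingleObj.id_as_one, map_one]; rfl
      map_comp := fun x y => by rw [SingleObj.comp_as_mul, map_mul]; rfl }
  let c : Cocone D :=
    { pt := B
      ι := { app := fun _ => φ
             naturality := fun _ _ x => by
               change (FreeMonoid.lift γ x).hom ≫ φ = φ ≫ 𝟙 B
               rw [Category.comp_id]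
               exact hφ.1 _ (hlift x) } }
  -- a cocone on `D` is a `Γ_A`-invariant arrow (detection), so `φ` is a colimit
  have hcocone : ∀ s : Cocone D, ∀ δ ∈ P.Γ, δ.hom ≫ s.ι.app (SingleObj.star _) = s.ι.app (SingleObj.star _) :=
    fun s => hdet _ fun n => by
      have h := s.w (j := SingleObj.star _) (j' := SingleObj.star _) (FreeMonoid.of n)
      exact h
  have hc : IsColimit c :=
    { desc := fun s => (hφ.2 (s.ι.app (SingleObj.star _)) (hcocone s)).choose
      fac := fun s j => (hφ.2 (s.ι.app (SingleObj.star _)) (hcocone s)).choose_spec.1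
      uniq := fun s m hm =>
        (hφ.2 (s.ι.app (SingleObj.star _)) (hcocone s)).choose_spec.2 m (hm (SingleObj.star _)) }
  -- `F` preserves this countable colimit
  haveI : CountableCategory (SingleObj (FreeMonoid ℕ)) := countableCategory_singleObj_freeMonoid
  haveI : PreservesColimitsOfShape (SingleObj (FreeMonoid ℕ)) F := hF _
  have hc' : IsColimit (F.mapCocone c) := isColimitOfPreserves F hc
  refine ⟨fun δ hδ => ?_, fun C' ψ' hψ' => ?_⟩
  · obtain ⟨δ₀, hδ₀, rfl⟩ := (mem_mapFunctor_obj_Γ_iff F P δ).mp hδ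
    change F.map δ₀.hom ≫ F.map φ = F.map φ
    rw [← F.map_comp, hφ.1 δ₀ hδ₀]
  · -- `ψ'` is a cocone on `D ⋙ F`
    let s' : Cocone (D ⋙ F) :=
      { pt := C'
        ι := { app := fun _ => ψ'
               naturality := fun _ _ x => by
                 change F.map (FreeMonoid.lift γ x).hom ≫ ψ' = ψ' ≫ 𝟙 C'
                 rw [Category.comp_id]
                 exact hψ' (Functor.mapAut P.A F (FreeMonoid.lift γ x))
                   (Subgroup.mem_map_of_mem _ (hlift x)) } }
    refine ⟨hc'.desc s', hc'.fac s' (SingleObj.star _), fun m hm => hc'.uniq s' m fun _ => hm⟩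

end Quotients

/-! ### `D₂ → D₁` preserves 1-proper morphisms -/

section OneProper

variable {Q : Type u₁} [Category.{v₁} Q] {Q' : Type u₂} [Category.{v₂} Q'] (F : Q ⥤ Q')

/-- **`D₂ → D₁` preserves 1-proper morphisms** (proof of Thm. A.4, p. 85: "since `φ^*` preserves
countable colimits, it follows that the functor `D₂ → D₁` preserves 0- and 1-proper morphisms [cf.
Remark A.3.1]"): for connected quasi-temperoids `Q`, `Q'` and `F : Q ⥤ Q'` preserving epimorphisms
and countable colimits, if `f : (A, Γ_A) → (B, Γ_B)` is 1-proper then so is `F f` — 0-properness by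
`Hom.IsZeroProper.map`; every `F γ_B` lifts to `F γ_A`; and `F A → F B` forms a quotient of
`(F A, Ker(F(Γ_A) ↠ F(Γ_B)))`: it forms one of `(F A, F(Ker(Γ_A ↠ Γ_B)))`
(`IsQuotient.map_of_preservesCountableColimits`) and is invariant under the larger kernel.
[cite: MochizukiSemiAnbd2006, Thm A.4 proof p.85] -/
theorem Hom.IsOneProper.map (hQ : IsConnectedQuasiTemperoid.{v₁, u₁, u} Q)
    (hQ' : IsConnectedQuasiTemperoid.{v₂, u₂, u'} Q') [F.PreservesEpimorphisms]
    (hF : ∀ (J : Type) [SmallCategory J] [CountableCategory J], PreservesColimitsOfShape J F)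
    {P₁ P₂ : QDPair Q} {f : P₁ ⟶ P₂} (hf : Hom.IsOneProper f) :
    Hom.IsOneProper ((mapFunctor F).map f) := by
  obtain ⟨h0, hsurj, hquot⟩ := hf
  refine ⟨h0.map F hQ hQ', fun δ' hδ' => ?_, ?_⟩
  · obtain ⟨γ', hγ', rfl⟩ := (mem_mapFunctor_obj_Γ_iff F P₂ δ').mp hδ'
    obtain ⟨γ, hγ, h⟩ := hsurj γ' hγ'
    refine ⟨Functor.mapAut P₁.A F γ, Subgroup.mem_map_of_mem _ hγ, ?_⟩
    change F.map f.hom ≫ F.map γ'.hom = F.map γ.hom ≫ F.map f.hom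
    rw [← F.map_comp, h, F.map_comp]
  · have hq := IsQuotient.map_of_preservesCountableColimits hQ F hF hquot
    refine hq.of_le ?_ fun δ hδ => hδ.2
    intro δ hδ
    obtain ⟨γ, hγ, rfl⟩ := Subgroup.mem_map.mp hδ
    refine ⟨Subgroup.mem_map_of_mem _ hγ.1, ?_⟩
    change F.map γ.hom ≫ F.map f.hom = F.map f.hom
    rw [← F.map_comp, hγ.2]

/-- **`D₂ → D₁` preserves 1-proper morphisms**, the printed hypothesis: `F` preserving countable
colimits (which entails preserving epimorphisms). [cite: MochizukiSemiAnbd2006, Thm A.4 proof p.85] -/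
theorem Hom.IsOneProper.map_of_preservesCountableColimits
    (hQ : IsConnectedQuasiTemperoid.{v₁, u₁, u} Q) (hQ' : IsConnectedQuasiTemperoid.{v₂, u₂, u'} Q')
    (hF : ∀ (J : Type) [SmallCategory J] [CountableCategory J], PreservesColimitsOfShape J F)
    {P₁ P₂ : QDPair Q} {f : P₁ ⟶ P₂} (hf : Hom.IsOneProper f) :
    Hom.IsOneProper ((mapFunctor F).map f) := by
  haveI := preservesEpimorphisms_of_preservesCountableColimits F hF
  exact hf.map F hQ hQ' hF

/-- **`D₂ → D₁` preserves 0-proper morphisms**, the printed hypothesis: `F` preserving countable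
colimits. [cite: MochizukiSemiAnbd2006, Thm A.4 proof p.85] -/
theorem Hom.IsZeroProper.map_of_preservesCountableColimits
    (hQ : IsConnectedQuasiTemperoid.{v₁, u₁, u} Q) (hQ' : IsConnectedQuasiTemperoid.{v₂, u₂, u'} Q')
    (hF : ∀ (J : Type) [SmallCategory J] [CountableCategory J], PreservesColimitsOfShape J F)
    {P₁ P₂ : QDPair Q} {f : P₁ ⟶ P₂} (hf : Hom.IsZeroProper f) :
    Hom.IsZeroProper ((mapFunctor F).map f) := by
  haveI := preservesEpimorphisms_of_preservesCountableColimits F hF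
  exact hf.map F hQ hQ'

end OneProper

/-! ### The setting of Theorem A.4: `φ : Q₁ = T₁[A₁] → Q₂ = T₂[A₂]` a morphism of quasi-temperoids -/

section ThmA4Setting

variable {T₁ : Type u₁} [Category.{v₁} T₁] {T₂ : Type u₂} [Category.{v₂} T₂]

/-- In the setting of Theorem A.4 (`T_i` connected temperoids, `A_i ∈ T_i` connected,
`φ : Q₁ = T₁[A₁] → Q₂ = T₂[A₂]` a morphism of quasi-temperoids, i.e. `φ^*` preserves finite limits and
countable colimits), **`D₂ → D₁` preserves 0-proper morphisms**.
[cite: MochizukiSemiAnbd2006, Thm A.4 proof p.85] -/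
theorem Hom.IsZeroProper.map_pullback (hT₁ : IsConnectedTemperoid.{v₁, u, u₁} T₁)
    (hT₂ : IsConnectedTemperoid.{v₂, u', u₂} T₂) {A₁ : T₁} {A₂ : T₂} (hA₁ : IsConnectedObj A₁)
    (hA₂ : IsConnectedObj A₂) (φ : TemperoidHom (Over' A₁) (Over' A₂))
    {P₁ P₂ : QDPair (Over' A₂)} {f : P₁ ⟶ P₂} (hf : Hom.IsZeroProper f) :
    Hom.IsZeroProper ((mapFunctor φ.pullback).map f) :=
  hf.map_of_preservesCountableColimits φ.pullback
    (isConnectedQuasiTemperoid_of_slice hT₂ hA₂ ⟨CategoryTheory.Equivalence.refl⟩)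
    (isConnectedQuasiTemperoid_of_slice hT₁ hA₁ ⟨CategoryTheory.Equivalence.refl⟩)
    φ.preservesCountableColimits

/-- In the setting of Theorem A.4, **`D₂ → D₁` preserves 1-proper morphisms**.
[cite: MochizukiSemiAnbd2006, Thm A.4 proof p.85] -/
theorem Hom.IsOneProper.map_pullback (hT₁ : IsConnectedTemperoid.{v₁, u, u₁} T₁)
    (hT₂ : IsConnectedTemperoid.{v₂, u', u₂} T₂) {A₁ : T₁} {A₂ : T₂} (hA₁ : IsConnectedObj A₁)
    (hA₂ : IsConnectedObj A₂) (φ : TemperoidHom (Over' A₁) (Over' A₂))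
    {P₁ P₂ : QDPair (Over' A₂)} {f : P₁ ⟶ P₂} (hf : Hom.IsOneProper f) :
    Hom.IsOneProper ((mapFunctor φ.pullback).map f) :=
  hf.map_of_preservesCountableColimits φ.pullback
    (isConnectedQuasiTemperoid_of_slice hT₂ hA₂ ⟨CategoryTheory.Equivalence.refl⟩)
    (isConnectedQuasiTemperoid_of_slice hT₁ hA₁ ⟨CategoryTheory.Equivalence.refl⟩)
    φ.preservesCountableColimits

/-- In the setting of Theorem A.4, **`φ^*` carries quotients of QD-pairs of `Q₂` to quotients of
QD-pairs of `Q₁`**. [cite: MochizukiSemiAnbd2006, Thm A.4 proof p.85] -/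
theorem IsQuotient.map_pullback (hT₂ : IsConnectedTemperoid.{v₂, u', u₂} T₂) {A₁ : T₁} {A₂ : T₂}
    (hA₂ : IsConnectedObj A₂) (φ : TemperoidHom (Over' A₁) (Over' A₂))
    {P : QDPair (Over' A₂)} {B : Over' A₂} {q : P.A ⟶ B} (hq : P.IsQuotient q) :
    ((mapFunctor φ.pullback).obj P).IsQuotient (φ.pullback.map q) :=
  hq.map_of_preservesCountableColimits
    (isConnectedQuasiTemperoid_of_slice hT₂ hA₂ ⟨CategoryTheory.Equivalence.refl⟩) φ.pullback
    φ.preservesCountableColimits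

end ThmA4Setting

end QDPair

end Literature.AnabelianGeometry.SemiGraphs
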